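import Mathlib
import Literature.Computability.AlgebraicComplexity.RealTauKnownCases

/-!
# Crux `MatrixDescartes` (stmt-ValiantsHypothesis-18050), line `Lift` — registered stub `stub_descartesCeiling`

The SHARP TRIVIAL (Descartes) CEILING for a lacunary matrix pencil
`P := det (∑ₗ X^{dₗ} • Sₗ)` (`K ≥ 1` terms, real `m × m` matrices `Sₗ`): the number `Z₊` of distinct
positive zeros of `P` satisfies `Z₊ + 1 ≤ C(m+K−1, m)`.

Proof.
* Leibniz expansion (`Matrix.det_apply'`) and `Fintype.prod_sum` write
  `P = ∑_σ ∑_{f : Fin m → Fin K} sign σ · C(∏ᵢ S (f i) (σ i) i) · X^(∑ᵢ d (f i))`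
  (`StubDescartesCeiling.det_pencil_eq`), so every exponent in the support of `P` is of the form
  `∑ᵢ d (f i)` for a row-to-term map `f` (`StubDescartesCeiling.coeff_det_pencil_eq_zero`).
* That exponent depends only on the MULTISET of values of `f`, an element of `Sym (Fin K) m`
  (`StubDescartesCeiling.sum_eq_sym_sum`), so the support has at most
  `card (Sym (Fin K) m) = C(K+m−1, m)` elements (stars and bars, Mathlib `Sym.card_sym_eq_choose`;
  `StubDescartesCeiling.card_support_det_pencil_le`).
* If `P = 0` no root is counted and `C(m+K−1, m) ≥ 1` because `m ≤ m+K−1` (`K ≥ 1`); otherwise the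
  sparse Descartes rule of the tree
  (`Literature.Computability.AlgebraicComplexity.card_roots_toFinset_filter_pos_lt_card_support`:
  a nonzero real polynomial has fewer distinct positive zeros than monomials) gives
  `Z₊ < #support ≤ C(m+K−1, m)`.

Elementary; Mathlib + the tree's sparse Descartes lemma (axioms `propext`, `Classical.choice`,
`Quot.sound`).
-/

-- layout Summits/ValiantsHypothesis/ValiantsHypothesis forces the duplicated namespace component
set_option linter.dupNamespace false

namespace Summit.ValiantsHypothesis.ValiantsHypothesis.Theorems.LacunarySymmetroidMatrixDescartes

open Polynomial Finset
open scoped BigOperators Polynomial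

namespace StubDescartesCeiling

-- adapted from Cruxes/MatrixDescartes/BirthDesignVet.lean (refuter-skel vet)

variable {K m : ℕ}

/-- Entries of the lacunary pencil `∑ₗ X^{dₗ} • Sₗ`: `(∑ₗ X^{dₗ} • Sₗ) i j = ∑ₗ X^{dₗ} · C (Sₗ i j)`. -/
theorem pencil_apply (d : Fin K → ℕ) (S : Fin K → Matrix (Fin m) (Fin m) ℝ) (i j : Fin m) :
    (∑ l, ((Polynomial.X : Polynomial ℝ) ^ d l) • (S l).map Polynomial.C) i j
      = ∑ l, X ^ d l * C (S l i j) := by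
  simp [Matrix.sum_apply, Matrix.smul_apply, smul_eq_mul]

/-- Leibniz expansion of the pencil determinant as a sum of monomials indexed by a permutation `σ`
and a row-to-term map `f : Fin m → Fin K`; the exponent `∑ᵢ d (f i)` depends on `f` only. -/
theorem det_pencil_eq (d : Fin K → ℕ) (S : Fin K → Matrix (Fin m) (Fin m) ℝ) :
    Matrix.det (∑ l, ((Polynomial.X : Polynomial ℝ) ^ d l) • (S l).map Polynomial.C) =
      ∑ σ : Equiv.Perm (Fin m), ∑ f : Fin m → Fin K,
        ((Equiv.Perm.sign σ : ℤ) : ℝ[X]) * (C (∏ i, S (f i) (σ i) i) * X ^ (∑ i, d (f i))) := by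
  rw [Matrix.det_apply']
  refine Finset.sum_congr rfl fun σ _ => ?_
  rw [← Finset.mul_sum]
  congr 1
  simp_rw [pencil_apply]
  rw [Fintype.prod_sum]
  refine Finset.sum_congr rfl fun f _ => ?_
  rw [Finset.prod_mul_distrib, Finset.prod_pow_eq_pow_sum, ← map_prod C, mul_comm]

/-- Coefficients of the pencil determinant vanish off the exponent set `{∑ᵢ d (f i)}`. -/
theorem coeff_det_pencil_eq_zero (d : Fin K → ℕ) (S : Fin K → Matrix (Fin m) (Fin m) ℝ) {n : ℕ}
    (hn : ∀ f : Fin m → Fin K, (∑ i, d (f i)) ≠ n) :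
    (Matrix.det (∑ l, ((Polynomial.X : Polynomial ℝ) ^ d l) • (S l).map Polynomial.C)).coeff n
      = 0 := by
  rw [det_pencil_eq, finsetSum_coeff]
  refine Finset.sum_eq_zero fun σ _ => ?_
  rw [finsetSum_coeff]
  refine Finset.sum_eq_zero fun f _ => ?_
  rw [← C_eq_intCast, ← mul_assoc, ← C_mul, coeff_C_mul_X_pow, if_neg (fun h => hn f h.symm)]

/-- The exponent `∑ᵢ d (f i)` factors through the multiset of values of `f`. -/
theorem sum_eq_sym_sum (d : Fin K → ℕ) (f : Fin m → Fin K) :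
    ∑ i, d (f i) = ((Finset.univ.val.map f).map d).sum := by
  rw [Multiset.map_map]
  rfl

/-- The multiset of values of a row-to-term map `f : Fin m → Fin K`, an element of
`Sym (Fin K) m`. -/
theorem card_map_univ_val (f : Fin m → Fin K) : Multiset.card (Finset.univ.val.map f) = m := by
  simp

/-- The support of the pencil determinant lies in the image of `Sym (Fin K) m` (multisets of `m`
term indices) under `s ↦ ∑_{l ∈ s} dₗ`. -/
theorem support_det_pencil_subset (d : Fin K → ℕ) (S : Fin K → Matrix (Fin m) (Fin m) ℝ) :
    (Matrix.det (∑ l, ((Polynomial.X : Polynomial ℝ) ^ d l) • (S l).map Polynomial.C)).support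
      ⊆ (Finset.univ : Finset (Sym (Fin K) m)).image
          (fun s : Sym (Fin K) m => ((s : Multiset (Fin K)).map d).sum) := by
  intro n hn
  rw [mem_support_iff] at hn
  by_contra h
  refine hn (coeff_det_pencil_eq_zero d S fun f hf => h ?_)
  refine Finset.mem_image.mpr ⟨⟨Finset.univ.val.map f, card_map_univ_val f⟩, Finset.mem_univ _, ?_⟩
  rw [← hf, sum_eq_sym_sum]
  rfl

/-- The pencil determinant has at most `C(m+K−1, m)` monomials (stars and bars on the count
vectors of row-to-term maps). -/
theorem card_support_det_pencil_le (d : Fin K → ℕ) (S : Fin K → Matrix (Fin m) (Fin m) ℝ) :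
    (Matrix.det (∑ l, ((Polynomial.X : Polynomial ℝ) ^ d l) • (S l).map Polynomial.C)).support.card
      ≤ Nat.choose (m + K - 1) m := by
  calc (Matrix.det (∑ l, ((Polynomial.X : Polynomial ℝ) ^ d l) • (S l).map Polynomial.C)).support.card
      ≤ ((Finset.univ : Finset (Sym (Fin K) m)).image
          (fun s : Sym (Fin K) m => ((s : Multiset (Fin K)).map d).sum)).card :=
        Finset.card_le_card (support_det_pencil_subset d S)
    _ ≤ (Finset.univ : Finset (Sym (Fin K) m)).card := Finset.card_image_le
    _ = Fintype.card (Sym (Fin K) m) := Finset.card_univ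
    _ = Nat.choose (K + m - 1) m := by rw [Sym.card_sym_eq_choose, Fintype.card_fin]
    _ = Nat.choose (m + K - 1) m := by rw [Nat.add_comm K m]

end StubDescartesCeiling

/-- **Registered stub `stub_descartesCeiling`** (the sharp Descartes ceiling by count vectors): for
`K ≥ 1`, the number of distinct positive zeros of `det (∑ₗ X^{dₗ} Sₗ)` (real `m × m` matrices `Sₗ`)
plus one is at most `C(m+K−1, m)`: the exponents of the determinant are the sums `∑ₗ nₗ dₗ` over
count vectors `n` with `∑ₗ nₗ = m` (`C(K+m−1, m)` of them, `Sym.card_sym_eq_choose`), and a nonzero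
real polynomial has fewer distinct positive zeros than monomials (sparse Descartes rule); the zero
polynomial has no counted roots and `C(m+K−1, m) ≥ 1`. No symmetry of the `Sₗ` is needed. -/
theorem stub_descartesCeiling (K m : ℕ) (hK : 0 < K) (d : Fin K → ℕ)
    (S : Fin K → Matrix (Fin m) (Fin m) ℝ) :
    ((Matrix.det (∑ l, ((Polynomial.X : Polynomial ℝ) ^ d l) • (S l).map Polynomial.C)).roots.toFinset.filter
        (fun t => 0 < t)).card + 1 ≤ Nat.choose (m + K - 1) m := by
  have hch : 1 ≤ Nat.choose (m + K - 1) m := Nat.choose_pos (by omega)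
  by_cases hP : Matrix.det (∑ l, ((Polynomial.X : Polynomial ℝ) ^ d l) • (S l).map Polynomial.C) = 0
  · rw [hP, Polynomial.roots_zero, Multiset.toFinset_zero, Finset.filter_empty, Finset.card_empty,
      zero_add]
    exact hch
  · have h1 :=
      Literature.Computability.AlgebraicComplexity.card_roots_toFinset_filter_pos_lt_card_support hP
    have h2 := StubDescartesCeiling.card_support_det_pencil_le d S
    exact Nat.succ_le_of_lt (lt_of_lt_of_le h1 h2)

end Summit.ValiantsHypothesis.ValiantsHypothesis.Theorems.LacunarySymmetroidMatrixDescartes
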